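import Literature.NumberTheory.EllipticCurves.Kobayashi2003.SignedKatoDivisibility
import Literature.NumberTheory.EllipticCurves.PAdicLFunctionNeZeroProofs
import Literature.NumberTheory.EllipticCurves.PAdicLFunctionProofs
import Literature.NumberTheory.EllipticCurves.PAdicLFunctionDistributionHoldsProofs
import HarnessLib

/-!
# The constant terms of Pollack's `L_p^±`: `L⁻(0) = 2·[0]⁺_f`, `L⁺(0) = (p−1)·[0]⁺_f` (proofs; no
# named fact)

Topic `Literature/NumberTheory/EllipticCurves`, cluster `Kobayashi2003`; sibling PROOF file of
`SignedKatoDivisibility.lean` (p209183: the predicate `IsSignedPAdicLFunction f p ε L`, Kobayashi's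
labelling of Pollack's `L_p^±` by the Mazur–Tate congruences of `pollack_exists_plusMinusPAdicLFunction`).
Everything is PROVED (net debt 0). HONEST FRAMING (cell `b2b-bsdres`, harvest seat 2, gen 12; binder
(P) `SignedDatum.Interpolation` of `Summits/…/Supersingular/SignedRankZero.lean`): nothing about any
curve is asserted beyond what is proved; no label moves.

## What is proved (Pollack 2003 §6, the interpolation at the trivial character; Kobayashi 2003 (3.6))

For `p` odd, `f` the newform of `E = W` with good reduction at `p` and `a_p = 0`, and `L ∈ Λ` with
`IsSignedPAdicLFunction f p ε L`, the constant term of `L` in the tree's normalisation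
`[r]⁺_f = ratPlusSymbol f r` (period `Ω⁺_f`; `[0]⁺_f = L(f,1)/Ω⁺_f`):
* `ε = 1` (Kobayashi's `+`, the tree's/Pollack's `L⁻`): **`L(0) = 2 · [0]⁺_f`**
  (`IsSignedPAdicLFunction.constantCoeff_eq_of_eq_one`);
* `ε = -1` (Kobayashi's `−`, the tree's/Pollack's `L⁺`): **`L(0) = (p − 1) · [0]⁺_f`**
  (`IsSignedPAdicLFunction.constantCoeff_eq_of_eq_neg_one`).
These are Pollack's `L_p^-(E,0) = 2·L(E,1)/Ω_E`, `L_p^+(E,0) = (p−1)·L(E,1)/Ω_E` (Duke Math. J. 118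
(2003), §6; quoted by Kobayashi, Invent. Math. 152 (2003), (3.6), in his swapped labelling
`L_p^+(E,0) = 2 L(E,1)/Ω_E`, `L_p^-(E,0) = (p−1) L(E,1)/Ω_E`), up to the period ratio `Ω⁺_f/Ω_E` and
the overall signs absorbed in the tree's conventions.

Proof. The level-`0` congruence (`n = 0` even: `ω_0 = T`, `ω_0^- = 1`, sign `(-1)^{0+1}`) evaluated
at `T = 0` (`IsCongrModOmega.eval₂_eq`; `T = 0` is a root of every `ω_n`) gives
`L⁻(0) = −θ_0(0)`; the level-`1` congruence (`n = 1` odd: `ω_1^+ = 1`, sign `−1`) gives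
`L⁺(0) = −θ_1(0)`. The value `θ_n(0)` is Birch's sum for the TRIVIAL character
(`eval₂_mazurTateElement_eq_ratTwistedSymbolSum` with `χ = 1`, even and of order `p⁰`):
`θ_n(0) = ∑_{a ∈ (ℤ/p^{n+1})^×} [a/p^{n+1}]⁺`. The Hecke relation at `p` with `a_p = 0`
(`intCast_mul_ratPlusSymbol`: `∑_{j mod p} [(r+j)/p]⁺ + [p r]⁺ = a_p [r]⁺ = 0`, rationality of the
symbols by `ratCast_ratPlusSymbol_holds` + `IsNewformOf.coeffField_eq_bot`, `p ∤ N` by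
`not_dvd_level_of_isNewformOf`) and translation invariance (`ratPlusSymbol_add_intCast_eq`) give
`∑_{j<p} [j/p]⁺ = −[0]⁺`, hence `∑_{a ∈ (ℤ/p)^×} [a/p]⁺ = −2[0]⁺`, and
`∑_{a ∈ (ℤ/p²)^×} [a/p²]⁺ = ∑_{a<p} (∑_{b<p} [(a/p + b)/p]⁺ − [a/p]⁺) = −p[0]⁺ + [0]⁺`.

## Contents

* §1 `eval₂_mazurTateElement_zero` — `θ_n(0) = ∑_{a ∈ (ℤ/p^{n+e₀})^×} [a/p^{n+e₀}]⁺_f` (cast to `ℂ_p`);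
* §2 `IsSignedPAdicLFunction.algebraMap_constantCoeff_eq_neg_eval₂_zero_of_eq_one / _neg_one` —
  `L(0) = −θ_0(0)` resp. `−θ_1(0)`;
* §3 the modular-symbol sums (`sum_range_ratPlusSymbol_div_eq`, `sum_isUnit_ratPlusSymbol_eq_of_eq`
  (`ℤ/p`), `sum_isUnit_ratPlusSymbol_eq_of_eq_sq` (`ℤ/p²`));
* §4 the two constant-term theorems.

References: [Pollack2003] §6 (Prop. 6.18 at `n = 0, 1`; the values `L_p^±(E,0)`), [Kobayashi2003]
(3.6) p. 7; [MazurTateTeitelbaum1986Invent] §I.4 (4.2) (Hecke relation of modular symbols).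
-/

noncomputable section

open scoped MatrixGroups ModularForm

open CongruenceSubgroup Polynomial Literature.NumberTheory.EllipticCurves
  Literature.NumberTheory.EllipticCurves.ModularForms

namespace Literature.NumberTheory.EllipticCurves.Kobayashi2003

/-! ## §1. `θ_n(0)` is Birch's sum for the trivial character -/

section ThetaZero

variable {p : ℕ} [Fact p.Prime] {N : ℕ} (f : CuspForm (Gamma0 N) 2)

/-- **`θ_n(0) = ∑_{a ∈ (ℤ/p^{n+e₀})^×} [a/p^{n+e₀}]⁺_f`**: the value of the Mazur–Tate element at
`T = 0` is Birch's twisted symbol sum for the TRIVIAL character modulo `p^{n+e₀}` (even, of order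
`p⁰`; `χ(γ) - 1 = 0`), i.e. the sum of `[a/p^{n+e₀}]⁺` over the units (non-units contribute `0`).
[cite: Pollack2003, Prop. 6.9 (proof)] [cite: MazurTateTeitelbaum1986Invent, §I.8 (8.6)] -/
theorem eval₂_mazurTateElement_zero (n : ℕ) :
    (mazurTateElement f p n).eval₂ (algebraMap ℚ ℂ_[p]) 0 =
      ((∑ a : ZMod (p ^ (n + cyclotomicExponent p)),
        (if IsUnit a then
          ratPlusSymbol f ((a.val : ℚ) / ((p ^ (n + cyclotomicExponent p) : ℕ) : ℚ)) else 0) : ℚ) :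
        ℂ_[p]) := by
  classical
  have hp : p.Prime := Fact.out
  haveI : NeZero (p ^ (n + cyclotomicExponent p)) := ⟨pow_ne_zero _ hp.ne_zero⟩
  set χ : DirichletCharacter ℂ_[p] (p ^ (n + cyclotomicExponent p)) := 1 with hχ
  have hγ : χ (cyclotomicGenerator p : ZMod (p ^ (n + cyclotomicExponent p))) = 1 :=
    MulChar.one_apply (isUnit_cyclotomicGenerator_cast p _)
  have heven : χ.Even := MulChar.one_apply isUnit_one.neg
  have hord : ∃ j : ℕ, orderOf χ = p ^ j := ⟨0, by rw [pow_zero, hχ, orderOf_one]⟩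
  have h := eval₂_mazurTateElement_eq_ratTwistedSymbolSum f χ heven hord
  rw [hγ, sub_self] at h
  rw [h, ratTwistedSymbolSum, Rat.cast_sum]
  refine Finset.sum_congr rfl fun a _ ↦ ?_
  by_cases ha : IsUnit a
  · rw [if_pos ha, hχ, MulChar.one_apply ha, one_mul]
  · rw [if_neg ha, hχ, MulChar.map_nonunit _ ha, zero_mul, Rat.cast_zero]

end ThetaZero

/-! ## §2. `L(0) = −θ_{n₀}(0)` from the congruence at the bottom level of parity `ε` -/

section ConstantFromCongruence

variable {p : ℕ} [Fact p.Prime] {N : ℕ} {f : CuspForm (Gamma0 N) 2}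

/-- Evaluating a power series with `p`-integral coefficients at `z = 0` returns its constant term.
[folklore] -/
private theorem tsum_coeff_mul_zero_pow (L : IwasawaAlgebra p) :
    ∑' k, ((algebraMap ℚ_[p] ℂ_[p]).comp (algebraMap ℤ_[p] ℚ_[p])) (PowerSeries.coeff k L) *
        (0 : ℂ_[p]) ^ k =
      ((algebraMap ℚ_[p] ℂ_[p]).comp (algebraMap ℤ_[p] ℚ_[p])) (PowerSeries.constantCoeff L) := by
  rw [tsum_eq_single 0 fun k hk ↦ by rw [zero_pow hk, mul_zero], pow_zero, mul_one,
    PowerSeries.coeff_zero_eq_constantCoeff]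

/-- A congruence `θ ≡ ω L (mod ω_n)` evaluated at `T = 0` (a root of `ω_n = (1+T)^{p^n} - 1`):
`θ(0) = ω(0) · L(0)` in `ℂ_p`. [cite: Pollack2003, Prop. 6.18 (proof)] -/
theorem _root_.Literature.NumberTheory.EllipticCurves.IsCongrModOmega.eval₂_zero_eq {n : ℕ}
    {θ : ℚ[X]} {ω : ℤ[X]} {L : IwasawaAlgebra p} (h : IsCongrModOmega p n θ ω L) :
    θ.eval₂ (algebraMap ℚ ℂ_[p]) 0 =
      ω.eval₂ (algebraMap ℤ ℂ_[p]) 0 *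
        ((algebraMap ℚ_[p] ℂ_[p]).comp (algebraMap ℤ_[p] ℚ_[p])) (PowerSeries.constantCoeff L) := by
  have h1 := h.eval₂_eq (z := 0) (by rw [norm_zero]; exact one_pos) (by rw [add_zero, one_pow])
  rwa [tsum_coeff_mul_zero_pow] at h1

/-- **`ε = 1`: `L(0) = −θ_0(0)`** — the level-`0` congruence `θ_0 ≡ (-1)^{0+1} ω_0^- L (mod ω_0)` with
`ω_0^- = 1`, at `T = 0`. [cite: Pollack2003, Prop. 6.18] [cite: Kobayashi2003, (3.4) (p. 7)] -/
theorem IsSignedPAdicLFunction.algebraMap_constantCoeff_eq_of_eq_one {L : IwasawaAlgebra p}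
    (hL : IsSignedPAdicLFunction f p 1 L) :
    ((algebraMap ℚ_[p] ℂ_[p]).comp (algebraMap ℤ_[p] ℚ_[p])) (PowerSeries.constantCoeff L) =
      -(mazurTateElement f p 0).eval₂ (algebraMap ℚ ℂ_[p]) 0 := by
  have h0 := ((isSignedPAdicLFunction_one_iff f p L).mp hL 0 (by decide)).eval₂_zero_eq
  rw [eval₂_mul, eval₂_pow, eval₂_neg, eval₂_one, cyclotomicOmegaMinus_zero, eval₂_one] at h0
  rw [h0]
  ring

/-- **`ε = -1`: `L(0) = −θ_1(0)`** — the level-`1` congruence `θ_1 ≡ (-1)^{0+1} ω_1^+ L (mod ω_1)`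
with `ω_1^+ = 1` (empty product), at `T = 0`. [cite: Pollack2003, Prop. 6.18] [cite: Kobayashi2003, (3.5) (p. 7)] -/
theorem IsSignedPAdicLFunction.algebraMap_constantCoeff_eq_of_eq_neg_one {L : IwasawaAlgebra p}
    (hL : IsSignedPAdicLFunction f p (-1) L) :
    ((algebraMap ℚ_[p] ℂ_[p]).comp (algebraMap ℤ_[p] ℚ_[p])) (PowerSeries.constantCoeff L) =
      -(mazurTateElement f p 1).eval₂ (algebraMap ℚ ℂ_[p]) 0 := by
  have h1 := ((isSignedPAdicLFunction_neg_one_iff f p L).mp hL 1 (by decide)).eval₂_zero_eq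
  have hω : cyclotomicOmegaPlus p 1 = 1 := by simp [cyclotomicOmegaPlus]
  rw [eval₂_mul, eval₂_pow, eval₂_neg, eval₂_one, hω, eval₂_one] at h1
  rw [h1]
  ring

end ConstantFromCongruence

/-! ## §3. The modular-symbol sums at levels `p` and `p²` for `a_p = 0` -/

section SymbolSums

variable {N : ℕ} [NeZero N] {f : CuspForm (Gamma0 N) 2} {p : ℕ} [Fact p.Prime]

/-- Reindexing a sum over `ℤ/m` by the representatives `0 ≤ a.val < m`. [folklore] -/
private theorem sum_univ_zmod_val {M : Type*} [AddCommMonoid M] (m : ℕ) [NeZero m] (g : ℕ → M) :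
    ∑ a : ZMod m, g a.val = ∑ k ∈ Finset.range m, g k := by
  refine Finset.sum_bij (fun a _ ↦ a.val) (fun a _ ↦ Finset.mem_range.mpr (ZMod.val_lt a))
    (fun a _ b _ h ↦ ZMod.val_injective m h) (fun k hk ↦ ?_) (fun _ _ ↦ rfl)
  exact ⟨(k : ZMod m), Finset.mem_univ _, ZMod.val_cast_of_lt (Finset.mem_range.mp hk)⟩

/-- **The Hecke relation at `p` with `a_p = 0`, in the form used here**: for the rational newform `f`
(`IsNewform0`, rational coefficients), `p ∤ N` and `a_p(f) = 0`:
`∑_{j<p} [(r + j)/p]⁺_f = −[p r]⁺_f` for every `r ∈ ℚ`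
(`intCast_mul_ratPlusSymbol`, Mazur–Tate–Teitelbaum 1986 §I.4 (4.2)). [cite: MazurTateTeitelbaum1986Invent, §I.4 (4.2)] -/
theorem sum_range_ratPlusSymbol_div_eq (hf0 : IsNewform0 f) (hQ : coeffField f = ⊥)
    (hpN : ¬ p ∣ N) (hap : cuspCoeff f p = ((0 : ℤ) : ℂ)) (r : ℚ) :
    ∑ j ∈ Finset.range p, ratPlusSymbol f ((r + j) / p) = -ratPlusSymbol f (p * r) := by
  have hp : p.Prime := Fact.out
  have h := intCast_mul_ratPlusSymbol p hf0 hp hpN hap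
    (fun r ↦ ratCast_ratPlusSymbol_holds hf0 hQ r) r
  rw [Int.cast_zero, zero_mul, Fin.sum_univ_eq_sum_range (fun j ↦ ratPlusSymbol f ((r + j) / p)) p]
    at h
  linarith

/-- `∑_{j<p} [j/p]⁺_f = −[0]⁺_f` (the case `r = 0`). [cite: MazurTateTeitelbaum1986Invent, §I.4 (4.2)] -/
theorem sum_range_ratPlusSymbol_div_prime_eq (hf0 : IsNewform0 f) (hQ : coeffField f = ⊥)
    (hpN : ¬ p ∣ N) (hap : cuspCoeff f p = ((0 : ℤ) : ℂ)) :
    ∑ j ∈ Finset.range p, ratPlusSymbol f ((j : ℚ) / p) = -ratPlusSymbol f 0 := by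
  have h := sum_range_ratPlusSymbol_div_eq hf0 hQ hpN hap 0
  simp only [zero_add, mul_zero] at h
  exact h

/-- **Level `p`**: `∑_{a ∈ (ℤ/p)^×} [a/p]⁺_f = −2[0]⁺_f` for `a_p = 0` (remove the term `a = 0`,
`[0/p]⁺ = [0]⁺`, from `∑_{j<p} [j/p]⁺ = −[0]⁺`). Stated for a modulus `m = p` (to be instantiated
at `m = p^{0+e₀}`). [cite: Pollack2003, §6 (the value `L_p^-(E,0) = 2L(E,1)/Ω_E`)] -/
theorem sum_isUnit_ratPlusSymbol_eq_of_eq (hf0 : IsNewform0 f) (hQ : coeffField f = ⊥)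
    (hpN : ¬ p ∣ N) (hap : cuspCoeff f p = ((0 : ℤ) : ℂ)) {m : ℕ} [NeZero m] (hm : m = p) :
    (∑ a : ZMod m, if IsUnit a then ratPlusSymbol f ((a.val : ℚ) / (m : ℚ)) else 0) =
      -2 * ratPlusSymbol f 0 := by
  classical
  have hp : p.Prime := Fact.out
  obtain rfl : p = m := hm.symm
  have hunit : ∀ a : ZMod p, IsUnit a ↔ ¬ p ∣ a.val := fun a ↦ by
    conv_lhs => rw [← ZMod.natCast_zmod_val a]
    have h := ZMod.isUnit_natCast_iff_not_dvd_pow (a := a.val) hp Nat.one_pos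
    rwa [pow_one] at h
  have hsum : (∑ a : ZMod p, if IsUnit a then ratPlusSymbol f ((a.val : ℚ) / (p : ℚ)) else 0) =
      ∑ k ∈ Finset.range p, (if ¬ p ∣ k then ratPlusSymbol f ((k : ℚ) / (p : ℚ)) else 0) := by
    rw [← sum_univ_zmod_val p (fun k ↦ if ¬ p ∣ k then ratPlusSymbol f ((k : ℚ) / (p : ℚ)) else 0)]
    refine Finset.sum_congr rfl fun a _ ↦ ?_
    simp only [hunit a]
  rw [hsum]
  -- for `k < p`: `p ∣ k ↔ k = 0`
  have hkey : ∀ k ∈ Finset.range p, (if ¬ p ∣ k then ratPlusSymbol f ((k : ℚ) / (p : ℚ)) else 0) =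
      ratPlusSymbol f ((k : ℚ) / (p : ℚ)) - if k = 0 then ratPlusSymbol f ((k : ℚ) / (p : ℚ)) else 0 := by
    intro k hk
    rw [Finset.mem_range] at hk
    by_cases h0 : k = 0
    · subst h0; simp
    · have hnd : ¬ p ∣ k := fun hd ↦ h0 (Nat.eq_zero_of_dvd_of_lt hd hk)
      rw [if_pos hnd, if_neg h0, sub_zero]
  rw [Finset.sum_congr rfl hkey, Finset.sum_sub_distrib, Finset.sum_ite_eq' (Finset.range p),
    if_pos (Finset.mem_range.mpr hp.pos), sum_range_ratPlusSymbol_div_prime_eq hf0 hQ hpN hap,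
    Nat.cast_zero, zero_div]
  ring

/-- **Level `p²`**: `∑_{a ∈ (ℤ/p²)^×} [a/p²]⁺_f = −(p − 1)[0]⁺_f` for `a_p = 0`: writing `a = b + p c`
(`0 ≤ b, c < p`), `a` is a unit iff `b ≠ 0`, and for `b ≠ 0`
`∑_{c<p} [(b + pc)/p²]⁺ = ∑_{c<p} [(b/p + c)/p]⁺ = −[b]⁺ = −[0]⁺` (Hecke at `r = b/p`, translation
invariance). Stated for a modulus `m = p·p`. [cite: Pollack2003, §6 (the value `L_p^+(E,0) = (p−1)L(E,1)/Ω_E`)] -/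
theorem sum_isUnit_ratPlusSymbol_eq_of_eq_sq (hf0 : IsNewform0 f) (hQ : coeffField f = ⊥)
    (hpN : ¬ p ∣ N) (hap : cuspCoeff f p = ((0 : ℤ) : ℂ)) {m : ℕ} [NeZero m] (hm : m = p * p) :
    (∑ a : ZMod m, if IsUnit a then ratPlusSymbol f ((a.val : ℚ) / (m : ℚ)) else 0) =
      -((p : ℚ) - 1) * ratPlusSymbol f 0 := by
  classical
  have hp : p.Prime := Fact.out
  have hp0 : (p : ℚ) ≠ 0 := Nat.cast_ne_zero.mpr hp.ne_zero
  obtain rfl : p * p = m := hm.symm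
  -- units modulo `p²`
  have hunit : ∀ a : ZMod (p * p), IsUnit a ↔ ¬ p ∣ a.val := fun a ↦ by
    conv_lhs => rw [← ZMod.natCast_zmod_val a]
    have h := ZMod.isUnit_natCast_iff_not_dvd_pow (a := a.val) hp Nat.two_pos
    rwa [pow_two] at h
  set G : ℕ → ℚ := fun k ↦ if ¬ p ∣ k then ratPlusSymbol f ((k : ℚ) / ((p * p : ℕ) : ℚ)) else 0
    with hG
  have hsum : (∑ a : ZMod (p * p),
      if IsUnit a then ratPlusSymbol f ((a.val : ℚ) / ((p * p : ℕ) : ℚ)) else 0) =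
      ∑ k ∈ Finset.range (p * p), G k := by
    rw [← sum_univ_zmod_val (p * p) G]
    refine Finset.sum_congr rfl fun a _ ↦ ?_
    simp only [hG, hunit a]
  rw [hsum, ← Fin.sum_univ_eq_sum_range G (p * p),
    ← finProdFinEquiv.sum_comp (fun x : Fin (p * p) ↦ G x), Fintype.sum_prod_type_right]
  simp only [finProdFinEquiv_apply_val]
  -- inner sum over `c` for fixed `b`: `k = b + p c`
  have hinner : ∀ b : Fin p, ∑ c : Fin p, G ((b : ℕ) + p * (c : ℕ)) =
      if (b : ℕ) = 0 then 0 else -ratPlusSymbol f 0 := by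
    intro b
    have hbp : (b : ℕ) < p := b.2
    have hdvd : ∀ c : ℕ, p ∣ (b : ℕ) + p * c ↔ (b : ℕ) = 0 := fun c ↦ by
      constructor
      · intro h
        have hb : p ∣ (b : ℕ) := (Nat.dvd_add_left (Dvd.intro _ rfl)).mp h
        exact Nat.eq_zero_of_dvd_of_lt hb hbp
      · intro h; rw [h, zero_add]; exact Dvd.intro _ rfl
    by_cases hb0 : (b : ℕ) = 0
    · rw [if_pos hb0]
      refine Finset.sum_eq_zero fun c _ ↦ ?_
      rw [hG]
      dsimp only
      rw [if_neg (not_not.mpr ((hdvd c).mpr hb0))]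
    · rw [if_neg hb0]
      have hterm : ∀ c : Fin p, G ((b : ℕ) + p * (c : ℕ)) =
          ratPlusSymbol f (((((b : ℕ) : ℚ) / p) + (c : ℕ)) / p) := by
        intro c
        have hq : ((((b : ℕ) + p * (c : ℕ) : ℕ) : ℚ)) / ((p * p : ℕ) : ℚ) =
            ((((b : ℕ) : ℚ) / p) + (c : ℕ)) / p := by
          push_cast
          field_simp
        rw [hG]
        dsimp only
        rw [if_pos (fun h ↦ hb0 ((hdvd c).mp h)), hq]
      rw [Finset.sum_congr rfl fun c _ ↦ hterm c,
        Fin.sum_univ_eq_sum_range (fun c ↦ ratPlusSymbol f (((((b : ℕ) : ℚ) / p) + c) / p)) p,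
        sum_range_ratPlusSymbol_div_eq hf0 hQ hpN hap, mul_div_cancel₀ _ hp0]
      have := ratPlusSymbol_add_intCast_eq f 0 ((b : ℕ) : ℤ)
      rw [zero_add, Int.cast_natCast] at this
      rw [this]
  rw [Finset.sum_congr rfl fun b _ ↦ hinner b,
    Fin.sum_univ_eq_sum_range (fun b ↦ if b = 0 then (0 : ℚ) else -ratPlusSymbol f 0) p]
  -- `∑_{b<p} (if b = 0 then 0 else -[0]) = -(p-1)[0]`
  have hcount : ∑ b ∈ Finset.range p, (if b = 0 then (0 : ℚ) else -ratPlusSymbol f 0) =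
      ∑ b ∈ Finset.range p, (-ratPlusSymbol f 0) -
        ∑ b ∈ Finset.range p, (if b = 0 then -ratPlusSymbol f 0 else 0) := by
    rw [← Finset.sum_sub_distrib]
    refine Finset.sum_congr rfl fun b _ ↦ ?_
    by_cases hb : b = 0
    · rw [if_pos hb, if_pos hb, sub_self]
    · rw [if_neg hb, if_neg hb, sub_zero]
  rw [hcount, Finset.sum_const, Finset.card_range, Finset.sum_ite_eq' (Finset.range p),
    if_pos (Finset.mem_range.mpr hp.pos), nsmul_eq_mul]
  ring

end SymbolSums

/-! ## §4. The constant terms -/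

section Main

variable {N : ℕ} [NeZero N] {f : CuspForm (Gamma0 N) 2} {p : ℕ} [Fact p.Prime]
  {W : WeierstrassCurve ℚ} [W.IsElliptic] [W.IsGloballyMinimal]

omit [NeZero N] [W.IsElliptic] [W.IsGloballyMinimal] in
/-- Pulling an identity in `ℂ_p` between an element of `ℤ_p` and a rational back to `ℚ_p`.
[folklore] -/
private theorem padic_eq_of_complex_eq {x : ℤ_[p]} {q : ℚ}
    (h : ((algebraMap ℚ_[p] ℂ_[p]).comp (algebraMap ℤ_[p] ℚ_[p])) x = (q : ℂ_[p])) :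
    ((x : ℤ_[p]) : ℚ_[p]) = (q : ℚ_[p]) := by
  apply (algebraMap ℚ_[p] ℂ_[p]).injective
  rw [map_ratCast]
  exact h

/-- **`ε = 1`: the constant term of Kobayashi's `L_p^+` (the tree's / Pollack's `L⁻`) is
`2·[0]⁺_f = 2·L(f,1)/Ω⁺_f`.** For `p` odd, `f` the newform of `E = W` with good reduction at `p` and
`a_p = 0`, every `L ∈ Λ` with `IsSignedPAdicLFunction f p 1 L` has
`L(0) = 2 · ratPlusSymbol f 0` (in `ℚ_p`). Pollack: `L_p^-(E,0) = 2 L(E,1)/Ω_E`; Kobayashi (3.6):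
`L_p^+(E,0) = 2 L(E,1)/Ω_E` (his labelling), both in the Néron normalisation; here in the tree's
`Ω⁺_f`-normalisation and sign convention. [cite: Kobayashi2003, (3.6) (p. 7)] [cite: Pollack2003, §6 (Prop. 6.18 at n = 0)] -/
theorem IsSignedPAdicLFunction.constantCoeff_eq_of_eq_one (hp2 : p ≠ 2) (hf : IsNewformOf W f)
    (hgood : W.HasGoodReductionAtPrime p) (hap : W.frobeniusTrace p = 0) {L : IwasawaAlgebra p}
    (hL : IsSignedPAdicLFunction f p 1 L) :
    ((PowerSeries.constantCoeff L : ℤ_[p]) : ℚ_[p]) = ((2 * ratPlusSymbol f 0 : ℚ) : ℚ_[p]) := by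
  classical
  have hp : p.Prime := Fact.out
  have hpN : ¬ p ∣ N := not_dvd_level_of_isNewformOf hf hgood
  have hap' : cuspCoeff f p = ((0 : ℤ) : ℂ) := by
    rw [cuspCoeff_eq_frobeniusTrace_of_isNewformOf_holds hf hgood, hap]
  have hQ : coeffField f = ⊥ := hf.coeffField_eq_bot
  have hm : p ^ (0 + cyclotomicExponent p) = p := by
    rw [zero_add, cyclotomicExponent, if_neg hp2, pow_one]
  haveI : NeZero (p ^ (0 + cyclotomicExponent p)) := ⟨pow_ne_zero _ hp.ne_zero⟩
  apply padic_eq_of_complex_eq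
  rw [hL.algebraMap_constantCoeff_eq_of_eq_one, eval₂_mazurTateElement_zero f 0,
    sum_isUnit_ratPlusSymbol_eq_of_eq hf.1 hQ hpN hap' hm]
  push_cast
  ring

/-- **`ε = -1`: the constant term of Kobayashi's `L_p^-` (the tree's / Pollack's `L⁺`) is
`(p−1)·[0]⁺_f = (p−1)·L(f,1)/Ω⁺_f`.** For `p` odd, `f` the newform of `E = W` with good reduction at
`p` and `a_p = 0`, every `L ∈ Λ` with `IsSignedPAdicLFunction f p (-1) L` has
`L(0) = (p − 1) · ratPlusSymbol f 0` (in `ℚ_p`). Pollack: `L_p^+(E,0) = (p−1) L(E,1)/Ω_E`; Kobayashi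
(3.6): `L_p^-(E,0) = (p−1) L(E,1)/Ω_E`. [cite: Kobayashi2003, (3.6) (p. 7)] [cite: Pollack2003, §6 (Prop. 6.18 at n = 1)] -/
theorem IsSignedPAdicLFunction.constantCoeff_eq_of_eq_neg_one (hp2 : p ≠ 2) (hf : IsNewformOf W f)
    (hgood : W.HasGoodReductionAtPrime p) (hap : W.frobeniusTrace p = 0) {L : IwasawaAlgebra p}
    (hL : IsSignedPAdicLFunction f p (-1) L) :
    ((PowerSeries.constantCoeff L : ℤ_[p]) : ℚ_[p]) =
      ((((p : ℚ) - 1) * ratPlusSymbol f 0 : ℚ) : ℚ_[p]) := by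
  classical
  have hp : p.Prime := Fact.out
  have hpN : ¬ p ∣ N := not_dvd_level_of_isNewformOf hf hgood
  have hap' : cuspCoeff f p = ((0 : ℤ) : ℂ) := by
    rw [cuspCoeff_eq_frobeniusTrace_of_isNewformOf_holds hf hgood, hap]
  have hQ : coeffField f = ⊥ := hf.coeffField_eq_bot
  have hm : p ^ (1 + cyclotomicExponent p) = p * p := by
    rw [cyclotomicExponent, if_neg hp2]; ring
  haveI : NeZero (p ^ (1 + cyclotomicExponent p)) := ⟨pow_ne_zero _ hp.ne_zero⟩
  apply padic_eq_of_complex_eq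
  rw [hL.algebraMap_constantCoeff_eq_of_eq_neg_one, eval₂_mazurTateElement_zero f 1,
    sum_isUnit_ratPlusSymbol_eq_of_eq_sq hf.1 hQ hpN hap' hm]
  push_cast
  ring

/-- **Both signs at once**: `L(0) = c_ε · [0]⁺_f` with `c_1 = 2`, `c_{-1} = p − 1` — in particular the
constant term is a `p`-ADIC UNIT multiple of `[0]⁺_f = L(f,1)/Ω⁺_f` for `p` odd (`2` and `p − 1` are
prime to `p`), the shape of the cell's binder `SignedDatum.Interpolation` ("`L^ε(0) = c · L(E,1)/Ω`
with `p ∤ c`") in the `Ω⁺_f`-normalisation. [cite: Kobayashi2003, (3.6) (p. 7)] [cite: Pollack2003, §6] -/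
theorem IsSignedPAdicLFunction.exists_constantCoeff_eq (hp2 : p ≠ 2) (hf : IsNewformOf W f)
    (hgood : W.HasGoodReductionAtPrime p) (hap : W.frobeniusTrace p = 0) {ε : ℤˣ}
    {L : IwasawaAlgebra p} (hL : IsSignedPAdicLFunction f p ε L) :
    ∃ c : ℕ, ¬ p ∣ c ∧
      ((PowerSeries.constantCoeff L : ℤ_[p]) : ℚ_[p]) = ((c * ratPlusSymbol f 0 : ℚ) : ℚ_[p]) := by
  have hp : p.Prime := Fact.out
  rcases Int.units_eq_one_or ε with rfl | rfl
  · refine ⟨2, fun h ↦ hp2 ((Nat.prime_dvd_prime_iff_eq hp Nat.prime_two).mp h), ?_⟩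
    rw [hL.constantCoeff_eq_of_eq_one hp2 hf hgood hap, Nat.cast_ofNat]
  · refine ⟨p - 1, fun h ↦ ?_, ?_⟩
    · have h0 : p - 1 = 0 := Nat.eq_zero_of_dvd_of_lt h (Nat.sub_lt hp.pos Nat.one_pos)
      have := hp.two_le
      omega
    · rw [hL.constantCoeff_eq_of_eq_neg_one hp2 hf hgood hap, Nat.cast_sub hp.one_le, Nat.cast_one]

end Main

end Literature.NumberTheory.EllipticCurves.Kobayashi2003

end
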